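import Summits.HodgeConjecture.HodgeCM.Model.ArchKTypeOfLine_1

/-! PORT of `HodgeCM/Model/ArchKTypeOfLine.lean` (HodgeCMPerL run 82) — part 2: continuation of `Summits.HodgeConjecture.HodgeCM.Model.ArchKTypeOfLine_1` (split at a top-level declaration boundary by port_pkg.py; scope re-opened below; declarations unchanged). -/

-- port_pkg: scope re-opened for this part (file-level context, then the namespace/section stack open at the cut)
set_option autoImplicit false
noncomputable section
open Filter Topology Complex
open NumberField NumberField.InfinitePlace NumberField.mixedEmbedding IsDedekindDomain MeasureTheory
open scoped Matrix TensorProduct Classical SchwartzMap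
open MulAction
open Literature.Geometry.ComplexHyperbolic.BallModel (U21 x₀ stabilizerEquivK21)
open Literature.NumberTheory.Automorphic.U21 (K21 matA sclD)
open Literature.AlgebraicGeometry.HodgeTheory
open Literature.AlgebraicGeometry.ShimuraVarieties Literature.AlgebraicGeometry.ShimuraVarieties.BallForms
open Literature.NumberTheory.Automorphic Literature.NumberTheory.Weil1964
open Literature.RepresentationTheory.KonnoKonno2007 Literature.RepresentationTheory.KonnoKonno2007.RealDualPair
open Literature.NumberTheory.GelbartRogawski1991 Literature.NumberTheory.GelbartRogawski1991.UnitaryDualPair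
open Literature.Analysis.SegalBargmann
open Literature.NumberTheory.Automorphic.PicardCM
open HodgeCM.Adelic HodgeCM.PerL34 HodgeCM.Model.HypCensus HodgeCM.Model.SupplyInstance HodgeCM.Model.ArchSideTerm
namespace HodgeCM.Model
section Line
variable (hHD : exists_isReal_hodgeModel) (hI : hodgePQ_independent_of_hodgeModel)
  (h₁ : BallQuotientUniformised)  (h₃ : CMAbelianVarietyRealised)
variable {L : CMField} {ι₁ : L →+* ℂ} (V : HermSpace3 L ι₁) (c : SeesawCtx L)
  (hGR : (cmSplittingDatum (L : Type) finProdFinEquiv (frameD V) (frameD_real V) (frameD_ne V) (dW c.D) (dW_real c.D)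
    (dW_ne c.D)).CompatibleSplitting)
  (hGR₀ : (cmSplittingDatum (L : Type) (e₁) (frameD V) (frameD_real V) (frameD_ne V) (lineVec (L : Type) (dW c.D 0))
    (fun _ => dW_real c.D 0) (fun _ => dW_ne c.D 0)).CompatibleSplitting)
  (hGR₁ : (cmSplittingDatum (L : Type) (e₁) (frameD V) (frameD_real V) (frameD_ne V) (lineVec (L : Type) (dW c.D 1))
    (fun _ => dW_real c.D 1) (fun _ => dW_ne c.D 1)).CompatibleSplitting)
  (hGR₂ : (cmSplittingDatum (L : Type) (e₁) (frameD V) (frameD_real V) (frameD_ne V) (lineVec (L : Type) (dW' c.D 0))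
    (fun _ => dW'_real c.D 0) (fun _ => dW'_ne c.D 0)).CompatibleSplitting)
  (hGR₃ : (cmSplittingDatum (L : Type) (e₁) (frameD V) (frameD_real V) (frameD_ne V) (lineVec (L : Type) (dW' c.D 1))
    (fun _ => dW'_real c.D 1) (fun _ => dW'_ne c.D 1)).CompatibleSplitting)
  (η : CMAdelic (L : Type) (frameD V) × CMAdelic (L : Type) (dW c.D) →* ℂˣ)
  (hη : ∀ γU ∈ CMRat (L : Type) (frameD V), ∀ γ ∈ CMRat (L : Type) (dW c.D), η (γU, γ) = 1)
  (hηc : Continuous fun p => ((η p : ℂˣ) : ℂ))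
  (h₁W : (∀ j, 0 < (ι₁ (dW c.D j)).re) ∨ ∀ j, (ι₁ (dW c.D j)).re < 0)
  (A : ∀ k : Fin 4, ArchLineInput V (lineRepD V c.D hGR hGR₀ hGR₁ hGR₂ hGR₃ η k))
  (hV : IsAnisotropic L V.Hm) (N : ℕ) (Γ₀ : Level V)
section One
variable
  (hlevel : ∀ δ ∈ levelImage hHD hI h₁ h₃ Γ₀ hV, ∃ x : (V.latticeModel printFact_unitaryCompact_holds).G,
    x ∈ (satLevelRegimeOf V hV Γ₀.K : Subgroup (V.latticeModel printFact_unitaryCompact_holds).G) ∧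
      (archSideOf V c hGR hGR₀ hGR₁ hGR₂ hGR₃ η hη hηc h₁W A).ιinf δ * x ∈ (V.latticeModel printFact_unitaryCompact_holds).Γ)
  (Φ₁ : Module.Dual ℂ (Fin 2 → ℂ) →ₗ[ℂ]
    SchwartzMap (DPIdx (Fin 2) Unit
      (PosIdx (cmXW (L : Type) (frameD V) (lineVec (L : Type) (dW c.D 1)) (fun _ => dW_real c.D 1) ι₁ (cmPlace (L : Type) ι₁)))
      (NegIdx (cmXW (L : Type) (frameD V) (lineVec (L : Type) (dW c.D 1)) (fun _ => dW_real c.D 1) ι₁ (cmPlace (L : Type) ι₁))) → ℝ) ℂ)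
  (Φ₂ : SchwartzMap ((Fin 3 × {v : {v : InfinitePlace ↥(maximalRealSubfield L) // v.IsReal} // v ≠ cmPlace (L : Type) ι₁}) → ℝ) ℂ)
  (ℓ₀ : Module.Dual ℂ (Fin 2 → ℂ))
  (arch₀ : blockFamilyOf (L : Type) e₁ (frameD V) (frameD_real V) (frameD_ne V) (lineVec (L : Type) (dW c.D 1))
      (fun _ => dW_real c.D 1) (fun _ => dW_ne c.D 1) ι₁ (blockPosEquiv V) (blockNegEquiv V) Φ₁ Φ₂ ℓ₀ = (A 1).Φinf)
  (harch : ∀ a : UnitaryGroup.arch (↥(maximalRealSubfield L)) L (IsCMField.complexConj L) 3 V.Hm,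
    UnitaryGroup.archAt (↥(maximalRealSubfield L)) L (IsCMField.complexConj L) 3 V.Hm (UnitaryGroup.cmPlace (L : Type) ι₁)
        (NumberField.complexConj_smul_infinitePlace (L : Type) _) (IsCMField.complexConj_ne_one (L : Type)) a = 1 →
    ∀ ℓ, ((archSideOf V c hGR hGR₀ hGR₁ hGR₂ hGR₃ η hη hηc h₁W A).P 1).ω
        (HodgeCM.Adelic.regimeEquiv L V.Hm hV
          (UnitaryGroup.archToAdelic (↥(maximalRealSubfield L)) L (IsCMField.complexConj L) 3 V.Hm a), 1)
        (testFun (↥(maximalRealSubfield L)) (Fin 3)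
          (blockFamilyOf (L : Type) e₁ (frameD V) (frameD_real V) (frameD_ne V) (lineVec (L : Type) (dW c.D 1))
            (fun _ => dW_real c.D 1) (fun _ => dW_ne c.D 1) ι₁ (blockPosEquiv V) (blockNegEquiv V) Φ₁ Φ₂ ℓ) (A 1).x₀ N) =
      testFun (↥(maximalRealSubfield L)) (Fin 3)
        (blockFamilyOf (L : Type) e₁ (frameD V) (frameD_real V) (frameD_ne V) (lineVec (L : Type) (dW c.D 1))
          (fun _ => dW_real c.D 1) (fun _ => dW_ne c.D 1) ι₁ (blockPosEquiv V) (blockNegEquiv V) Φ₁ Φ₂ ℓ) (A 1).x₀ N)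
  (hfin : ∀ kf : UnitaryGroup.finAdelic (↥(maximalRealSubfield L)) L (IsCMField.complexConj L) 3 V.Hm, kf ∈ Γ₀.K →
    ∀ Φinf : 𝓢((Fin 3 → mixedSpace (↥(maximalRealSubfield L))), ℂ),
      ((archSideOf V c hGR hGR₀ hGR₁ hGR₂ hGR₃ η hη hηc h₁W A).P 1).ω
          (HodgeCM.Adelic.regimeEquiv L V.Hm hV
            (UnitaryGroup.finAdelicToAdelic (↥(maximalRealSubfield L)) L (IsCMField.complexConj L) 3 V.Hm kf), 1)
          (testFun (↥(maximalRealSubfield L)) (Fin 3) Φinf (A 1).x₀ N) =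
        testFun (↥(maximalRealSubfield L)) (Fin 3) Φinf (A 1).x₀ N)
  (hsec : ∀ u : stabilizer U21 x₀,
    cmBlockSection (L : Type) (frameD V) (frameD_real V) (frameD_ne V) (lineVec (L : Type) (dW c.D 1)) (fun _ => dW_real c.D 1)
        (fun _ => dW_ne c.D 1) ι₁ (blockPosEquiv V) (blockNegEquiv V) (u21FrameEquiv (u : U21), 1) = (archSectionFrameOf V u, 1))
  {ev : VacExponents}
  (hK : ∀ (kk : DPK (Fin 2) Unit
      (PosIdx (cmXW (L : Type) (frameD V) (lineVec (L : Type) (dW c.D 1)) (fun _ => dW_real c.D 1) ι₁ (cmPlace (L : Type) ι₁)))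
      (NegIdx (cmXW (L : Type) (frameD V) (lineVec (L : Type) (dW c.D 1)) (fun _ => dW_real c.D 1) ι₁ (cmPlace (L : Type) ι₁))))
    (Φ : SchwartzMap (DPIdx (Fin 2) Unit
      (PosIdx (cmXW (L : Type) (frameD V) (lineVec (L : Type) (dW c.D 1)) (fun _ => dW_real c.D 1) ι₁ (cmPlace (L : Type) ι₁)))
      (NegIdx (cmXW (L : Type) (frameD V) (lineVec (L : Type) (dW c.D 1)) (fun _ => dW_real c.D 1) ι₁ (cmPlace (L : Type) ι₁))) → ℝ) ℂ),
    cmBlockRep (L : Type) e₁ (frameD V) (frameD_real V) (frameD_ne V) (lineVec (L : Type) (dW c.D 1)) (fun _ => dW_real c.D 1)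
        (fun _ => dW_ne c.D 1) hGR₁ ι₁ (blockPosEquiv V) (blockNegEquiv V)
        (cmBlockSection (L : Type) (frameD V) (frameD_real V) (frameD_ne V) (lineVec (L : Type) (dW c.D 1)) (fun _ => dW_real c.D 1)
          (fun _ => dW_ne c.D 1) ι₁ (blockPosEquiv V) (blockNegEquiv V) (κ _ _ _ _ kk)) (tensorPi Φ Φ₂) =
      tensorPi (κOp _ _ ev kk Φ) Φ₂)
  (hΦ₁ : ∀ (kV : Matrix.unitaryGroup (Fin 2) ℂ × Matrix.unitaryGroup Unit ℂ) (b : Fin 2 → ℂ),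
    unitaryOpPi (dualPairι ((kV, 1) : DPK (Fin 2) Unit
        (PosIdx (cmXW (L : Type) (frameD V) (lineVec (L : Type) (dW c.D 1)) (fun _ => dW_real c.D 1) ι₁ (cmPlace (L : Type) ι₁)))
        (NegIdx (cmXW (L : Type) (frameD V) (lineVec (L : Type) (dW c.D 1)) (fun _ => dW_real c.D 1) ι₁ (cmPlace (L : Type) ι₁)))))
        (Φ₁ (dotProductEquiv ℂ (Fin 2) b)) =
      Φ₁ (dotProductEquiv ℂ (Fin 2) ((kV.1 : Matrix (Fin 2) (Fin 2) ℂ) *ᵥ b)))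
  (hχ : ∀ u : stabilizer U21 x₀,
    ((lineScalar_one V c.D hGR hGR₀ hGR₁ (eta₁ V c.D η) (u : U21) : ℂˣ) : ℂ) *
        ((matA (stabilizerEquivK21.symm u)).det ^ ev.eP * sclD (stabilizerEquivK21.symm u) ^ ev.eQ) =
      star (sclD (stabilizerEquivK21.symm u)))
/-- unfolding (`rfl`). -/
theorem archKTypeOfLineOne_def :
    archKTypeOfLineOne hHD hI h₁ h₃ V c hGR hGR₀ hGR₁ hGR₂ hGR₃ η hη hηc h₁W A hV N Γ₀ hlevel Φ₁ Φ₂ ℓ₀ arch₀ harch hfin hsec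
        hK hΦ₁ hχ =
      archKTypeOf hHD hI h₁ h₃ (archSideOf V c hGR hGR₀ hGR₁ hGR₂ hGR₃ η hη hηc h₁W A) hV 1 N Γ₀ Γ₀.K
        (satLevelRegimeOf_le_archFinOf V hV Γ₀.K) hlevel (fun _ hg => hg)
        (lineOmega_one V c.D hGR hGR₀ hGR₁ (eta₁ V c.D η))
        (fun g => lineRepOf_one_archInfOf_eq V c.D hGR hGR₀ hGR₁ hGR₂ hGR₃ (eta₀ V c.D η) (eta₁ V c.D η) (eta₂ V c.D η)
          (eta₃ V c.D η) hV g)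
        (blockFamilyOf (L : Type) e₁ (frameD V) (frameD_real V) (frameD_ne V) (lineVec (L : Type) (dW c.D 1)) (fun _ => dW_real c.D 1)
          (fun _ => dW_ne c.D 1) ι₁ (blockPosEquiv V) (blockNegEquiv V) Φ₁ Φ₂)
        ℓ₀ arch₀
        (satLevel_fix_of_arch_of_fin (archSideOf V c hGR hGR₀ hGR₁ hGR₂ hGR₃ η hη hηc h₁W A) hV 1 N Γ₀.K
          (fun ℓ => blockFamilyOf (L : Type) e₁ (frameD V) (frameD_real V) (frameD_ne V) (lineVec (L : Type) (dW c.D 1))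
            (fun _ => dW_real c.D 1) (fun _ => dW_ne c.D 1) ι₁ (blockPosEquiv V) (blockNegEquiv V) Φ₁ Φ₂ ℓ) harch hfin)
        (lineOmega_one_harm V c.D hGR hGR₀ hGR₁ (eta₁ V c.D η) Φ₁ Φ₂ hsec hK hΦ₁ hχ) :=
  rfl

set_option backward.isDefEq.respectTransparency false in
/-- **ROW 14 (`hpd`) FOR LINE 1 AT THE HONEST S TERM, along E's chart `BallForms.expP`** — modulo ONE existence statement, the
slot's small archimedean Weil datum (`hslot`, binder-2's currency).  The four sign facts are discharged (`frameD_sign_ι₁'`, the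
plane sign `h₁W`, `frameD_sign_of_ne`, `line_hsW`); BRICK 4 runs along `twistU21 ∘ expP` (#CA4v3 + #CA9 `hωA`) and #CA10 moves the
conclusion to `expP` (branch-free). -/
theorem isWeaklyPDiff_archKTypeOfLineOne
    (hslot : ∃ ω₁ : Representation ℂ
        (Ginf (Fin 2) Unit
          (PosIdx (cmXW (L : Type) (frameD V) (lineVec (L : Type) (dW c.D 1)) (fun _ => dW_real c.D 1) ι₁ (cmPlace (L : Type) ι₁)))
          (NegIdx (cmXW (L : Type) (frameD V) (lineVec (L : Type) (dW c.D 1)) (fun _ => dW_real c.D 1) ι₁ (cmPlace (L : Type) ι₁))))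
        (SchwartzMap (DPIdx (Fin 2) Unit
          (PosIdx (cmXW (L : Type) (frameD V) (lineVec (L : Type) (dW c.D 1)) (fun _ => dW_real c.D 1) ι₁ (cmPlace (L : Type) ι₁)))
          (NegIdx (cmXW (L : Type) (frameD V) (lineVec (L : Type) (dW c.D 1)) (fun _ => dW_real c.D 1) ι₁ (cmPlace (L : Type) ι₁))) → ℝ)
          ℂ),
      IsArchWeilDatum (ι𝕎 (Fin 2) Unit _ _) ω₁ ∧ ∀ u, Continuous (ω₁ u)) :
    (archKTypeOfLineOne hHD hI h₁ h₃ V c hGR hGR₀ hGR₁ hGR₂ hGR₃ η hη hηc h₁W A hV N Γ₀ hlevel Φ₁ Φ₂ ℓ₀ arch₀ harch hfin hsec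
        hK hΦ₁ hχ).IsWeaklyPDiff BallForms.expP := by
  obtain ⟨ω₁, hW₁, hc₁⟩ := hslot
  obtain ⟨ev₁, hvac₁⟩ := (junction (Fin 2) Unit _ _).exists_vacExponents hW₁
  refine (ArchKTypeData.isWeaklyPDiff_twistVec_iff
    (X := thetaSpaceInputIn hHD hI h₁ h₃ (archSideOf V c hGR hGR₀ hGR₁ hGR₂ hGR₃ η hη hηc h₁W A) hV) _ BallForms.expP).1 ?_
  rw [← twistU21_comp_expP, archKTypeOfLineOne_def]
  exact isWeaklyPDiff_archKTypeOf_blockPair hHD hI h₁ h₃ _ hV 1 N Γ₀ Γ₀.K _ hlevel _ _ _ e₁ (frameD V) (frameD_real V)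
    (frameD_ne V) (lineVec (L : Type) (dW c.D 1)) (fun _ => dW_real c.D 1) (fun _ => dW_ne c.D 1) hGR₁ (blockPosEquiv V)
    (blockNegEquiv V) Φ₁ Φ₂ ℓ₀ arch₀ _ _ (frameD_sign_ι₁' V) (line_hs₁W h₁W 1) (frameD_sign_of_ne V)
    (fun τ hτ => line_hsW (dW c.D 1) τ hτ) hW₁ hc₁ hvac₁ (fun b => twistU21 L ι₁ (BallForms.expP b))
    (lineOmega_one_twistU21_expP V c.D hGR hGR₀ hGR₁ (eta₁ V c.D η))

set_option backward.isDefEq.respectTransparency false in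
/-- **ROW 14 FOR LINE 1, HYPOTHESIS-FREE AT A POSITIVE LINE**: if line 1 is positive at `v₁` (`NegIdx (x_W(v₁))` empty,
`PosIdx` nonempty — the sign (χ) forces anyway), `hpd` holds for the assembled term along `BallForms.expP`. -/
theorem isWeaklyPDiff_archKTypeOfLineOne_of_pos
    [Nonempty (PosIdx (cmXW (L : Type) (frameD V) (lineVec (L : Type) (dW c.D 1)) (fun _ => dW_real c.D 1) ι₁ (cmPlace (L : Type) ι₁)))]
    [IsEmpty (NegIdx (cmXW (L : Type) (frameD V) (lineVec (L : Type) (dW c.D 1)) (fun _ => dW_real c.D 1) ι₁ (cmPlace (L : Type) ι₁)))] :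
    (archKTypeOfLineOne hHD hI h₁ h₃ V c hGR hGR₀ hGR₁ hGR₂ hGR₃ η hη hηc h₁W A hV N Γ₀ hlevel Φ₁ Φ₂ ℓ₀ arch₀ harch hfin hsec
        hK hΦ₁ hχ).IsWeaklyPDiff BallForms.expP :=
  isWeaklyPDiff_archKTypeOfLineOne hHD hI h₁ h₃ V c hGR hGR₀ hGR₁ hGR₂ hGR₃ η hη hηc h₁W A hV N Γ₀ hlevel Φ₁ Φ₂ ℓ₀ arch₀ harch
    hfin hsec hK hΦ₁ hχ exists_isArchWeilDatum_lineSlot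

set_option backward.isDefEq.respectTransparency false in
/-- **ROW 15 (`hk`) FOR LINE 1 ALONG THE TWISTED CHART `twistU21 ∘ expP`** (END-STATE shape `∀ p`), modulo the slot datum and
the harmonicity relations `hf` of `Φ₁`; the passage to `expP` itself is the (TWIST-2) item (route (a): `twistU21 = id`). -/
theorem isPMinusKilledAlong_archKTypeOfLineOne_twist
    (hslot : ∃ ω₁ : Representation ℂ
        (Ginf (Fin 2) Unit
          (PosIdx (cmXW (L : Type) (frameD V) (lineVec (L : Type) (dW c.D 1)) (fun _ => dW_real c.D 1) ι₁ (cmPlace (L : Type) ι₁)))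
          (NegIdx (cmXW (L : Type) (frameD V) (lineVec (L : Type) (dW c.D 1)) (fun _ => dW_real c.D 1) ι₁ (cmPlace (L : Type) ι₁))))
        (SchwartzMap (DPIdx (Fin 2) Unit
          (PosIdx (cmXW (L : Type) (frameD V) (lineVec (L : Type) (dW c.D 1)) (fun _ => dW_real c.D 1) ι₁ (cmPlace (L : Type) ι₁)))
          (NegIdx (cmXW (L : Type) (frameD V) (lineVec (L : Type) (dW c.D 1)) (fun _ => dW_real c.D 1) ι₁ (cmPlace (L : Type) ι₁))) → ℝ)
          ℂ),
      IsArchWeilDatum (ι𝕎 (Fin 2) Unit _ _) ω₁ ∧ ∀ u, Continuous (ω₁ u))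
    (hf : ∀ (p : Fin 2) (ℓ : Module.Dual ℂ (Fin 2 → ℂ)),
      hypOpGen (PosIdx (cmXW (L : Type) (frameD V) (lineVec (L : Type) (dW c.D 1)) (fun _ => dW_real c.D 1) ι₁ (cmPlace (L : Type) ι₁)))
          (NegIdx (cmXW (L : Type) (frameD V) (lineVec (L : Type) (dW c.D 1)) (fun _ => dW_real c.D 1) ι₁ (cmPlace (L : Type) ι₁))) p ()
          (Φ₁ ℓ) +
        Complex.I • rotBoostGen
          (PosIdx (cmXW (L : Type) (frameD V) (lineVec (L : Type) (dW c.D 1)) (fun _ => dW_real c.D 1) ι₁ (cmPlace (L : Type) ι₁)))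
          (NegIdx (cmXW (L : Type) (frameD V) (lineVec (L : Type) (dW c.D 1)) (fun _ => dW_real c.D 1) ι₁ (cmPlace (L : Type) ι₁))) p ()
          (Real.pi / 2) (Φ₁ ℓ) = 0) :
    ∀ p : Fin 2,
      (archKTypeOfLineOne hHD hI h₁ h₃ V c hGR hGR₀ hGR₁ hGR₂ hGR₃ η hη hηc h₁W A hV N Γ₀ hlevel Φ₁ Φ₂ ℓ₀ arch₀ harch hfin hsec
          hK hΦ₁ hχ).IsPMinusKilledAlong (fun b => twistU21 L ι₁ (BallForms.expP b)) (-Complex.I • (Pi.single p 1 : Fin 2 → ℂ)) := by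
  obtain ⟨ω₁, hW₁, hc₁⟩ := hslot
  rw [archKTypeOfLineOne_def]
  exact isPMinusKilledAlong_archKTypeOf_blockPair hHD hI h₁ h₃ _ hV 1 N Γ₀ Γ₀.K _ hlevel _ _ _ e₁ (frameD V) (frameD_real V)
    (frameD_ne V) (lineVec (L : Type) (dW c.D 1)) (fun _ => dW_real c.D 1) (fun _ => dW_ne c.D 1) hGR₁ (blockPosEquiv V)
    (blockNegEquiv V) Φ₁ Φ₂ ℓ₀ arch₀ _ _ (frameD_sign_ι₁' V) (line_hs₁W h₁W 1) (frameD_sign_of_ne V)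
    (fun τ hτ => line_hsW (dW c.D 1) τ hτ) hW₁ hc₁ (fun b => twistU21 L ι₁ (BallForms.expP b))
    (lineOmega_one_twistU21_expP V c.D hGR hGR₀ hGR₁ (eta₁ V c.D η)) hf

end One

/-! ### E's binder shape: the `k`-dispatched term for `k = 0 ∨ k = 1` (decidable split; model1 01:07:36Z TYPE remark) -/

section Dispatch

variable
  (hlevel : ∀ δ ∈ levelImage hHD hI h₁ h₃ Γ₀ hV, ∃ x : (V.latticeModel printFact_unitaryCompact_holds).G,
    x ∈ (satLevelRegimeOf V hV Γ₀.K : Subgroup (V.latticeModel printFact_unitaryCompact_holds).G) ∧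
      (archSideOf V c hGR hGR₀ hGR₁ hGR₂ hGR₃ η hη hηc h₁W A).ιinf δ * x ∈ (V.latticeModel printFact_unitaryCompact_holds).Γ)
  (Φ₁₀' : Module.Dual ℂ (Fin 2 → ℂ) →ₗ[ℂ]
    SchwartzMap (DPIdx (Fin 2) Unit
      (PosIdx (cmXW (L : Type) (frameD V) (lineVec (L : Type) (dW c.D 0)) (fun _ => dW_real c.D 0) ι₁ (cmPlace (L : Type) ι₁)))
      (NegIdx (cmXW (L : Type) (frameD V) (lineVec (L : Type) (dW c.D 0)) (fun _ => dW_real c.D 0) ι₁ (cmPlace (L : Type) ι₁))) → ℝ) ℂ)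
  (Φ₂₀' : SchwartzMap ((Fin 3 × {v : {v : InfinitePlace ↥(maximalRealSubfield L) // v.IsReal} // v ≠ cmPlace (L : Type) ι₁}) → ℝ) ℂ)
  (ℓ₀₀' : Module.Dual ℂ (Fin 2 → ℂ))
  (arch₀₀' : blockFamilyOf (L : Type) e₁ (frameD V) (frameD_real V) (frameD_ne V) (lineVec (L : Type) (dW c.D 0))
      (fun _ => dW_real c.D 0) (fun _ => dW_ne c.D 0) ι₁ (blockPosEquiv V) (blockNegEquiv V) Φ₁₀' Φ₂₀' ℓ₀₀' = (A 0).Φinf)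
  (harch₀' : ∀ a : UnitaryGroup.arch (↥(maximalRealSubfield L)) L (IsCMField.complexConj L) 3 V.Hm,
    UnitaryGroup.archAt (↥(maximalRealSubfield L)) L (IsCMField.complexConj L) 3 V.Hm (UnitaryGroup.cmPlace (L : Type) ι₁)
        (NumberField.complexConj_smul_infinitePlace (L : Type) _) (IsCMField.complexConj_ne_one (L : Type)) a = 1 →
    ∀ ℓ, ((archSideOf V c hGR hGR₀ hGR₁ hGR₂ hGR₃ η hη hηc h₁W A).P 0).ω
        (HodgeCM.Adelic.regimeEquiv L V.Hm hV
          (UnitaryGroup.archToAdelic (↥(maximalRealSubfield L)) L (IsCMField.complexConj L) 3 V.Hm a), 1)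
        (testFun (↥(maximalRealSubfield L)) (Fin 3)
          (blockFamilyOf (L : Type) e₁ (frameD V) (frameD_real V) (frameD_ne V) (lineVec (L : Type) (dW c.D 0))
            (fun _ => dW_real c.D 0) (fun _ => dW_ne c.D 0) ι₁ (blockPosEquiv V) (blockNegEquiv V) Φ₁₀' Φ₂₀' ℓ) (A 0).x₀ N) =
      testFun (↥(maximalRealSubfield L)) (Fin 3)
        (blockFamilyOf (L : Type) e₁ (frameD V) (frameD_real V) (frameD_ne V) (lineVec (L : Type) (dW c.D 0))
          (fun _ => dW_real c.D 0) (fun _ => dW_ne c.D 0) ι₁ (blockPosEquiv V) (blockNegEquiv V) Φ₁₀' Φ₂₀' ℓ) (A 0).x₀ N)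
  (hfin₀' : ∀ kf : UnitaryGroup.finAdelic (↥(maximalRealSubfield L)) L (IsCMField.complexConj L) 3 V.Hm, kf ∈ Γ₀.K →
    ∀ Φinf : 𝓢((Fin 3 → mixedSpace (↥(maximalRealSubfield L))), ℂ),
      ((archSideOf V c hGR hGR₀ hGR₁ hGR₂ hGR₃ η hη hηc h₁W A).P 0).ω
          (HodgeCM.Adelic.regimeEquiv L V.Hm hV
            (UnitaryGroup.finAdelicToAdelic (↥(maximalRealSubfield L)) L (IsCMField.complexConj L) 3 V.Hm kf), 1)
          (testFun (↥(maximalRealSubfield L)) (Fin 3) Φinf (A 0).x₀ N) =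
        testFun (↥(maximalRealSubfield L)) (Fin 3) Φinf (A 0).x₀ N)
  (hsec₀' : ∀ u : stabilizer U21 x₀,
    cmBlockSection (L : Type) (frameD V) (frameD_real V) (frameD_ne V) (lineVec (L : Type) (dW c.D 0)) (fun _ => dW_real c.D 0)
        (fun _ => dW_ne c.D 0) ι₁ (blockPosEquiv V) (blockNegEquiv V) (u21FrameEquiv (u : U21), 1) = (archSectionFrameOf V u, 1))
  {ev₀' : VacExponents}
  (hK₀' : ∀ (kk : DPK (Fin 2) Unit
      (PosIdx (cmXW (L : Type) (frameD V) (lineVec (L : Type) (dW c.D 0)) (fun _ => dW_real c.D 0) ι₁ (cmPlace (L : Type) ι₁)))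
      (NegIdx (cmXW (L : Type) (frameD V) (lineVec (L : Type) (dW c.D 0)) (fun _ => dW_real c.D 0) ι₁ (cmPlace (L : Type) ι₁))))
    (Φ : SchwartzMap (DPIdx (Fin 2) Unit
      (PosIdx (cmXW (L : Type) (frameD V) (lineVec (L : Type) (dW c.D 0)) (fun _ => dW_real c.D 0) ι₁ (cmPlace (L : Type) ι₁)))
      (NegIdx (cmXW (L : Type) (frameD V) (lineVec (L : Type) (dW c.D 0)) (fun _ => dW_real c.D 0) ι₁ (cmPlace (L : Type) ι₁))) → ℝ) ℂ),
    cmBlockRep (L : Type) e₁ (frameD V) (frameD_real V) (frameD_ne V) (lineVec (L : Type) (dW c.D 0)) (fun _ => dW_real c.D 0)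
        (fun _ => dW_ne c.D 0) hGR₀ ι₁ (blockPosEquiv V) (blockNegEquiv V)
        (cmBlockSection (L : Type) (frameD V) (frameD_real V) (frameD_ne V) (lineVec (L : Type) (dW c.D 0)) (fun _ => dW_real c.D 0)
          (fun _ => dW_ne c.D 0) ι₁ (blockPosEquiv V) (blockNegEquiv V) (κ _ _ _ _ kk)) (tensorPi Φ Φ₂₀') =
      tensorPi (κOp _ _ ev₀' kk Φ) Φ₂₀')
  (hΦ₁₀' : ∀ (kV : Matrix.unitaryGroup (Fin 2) ℂ × Matrix.unitaryGroup Unit ℂ) (b : Fin 2 → ℂ),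
    unitaryOpPi (dualPairι ((kV, 1) : DPK (Fin 2) Unit
        (PosIdx (cmXW (L : Type) (frameD V) (lineVec (L : Type) (dW c.D 0)) (fun _ => dW_real c.D 0) ι₁ (cmPlace (L : Type) ι₁)))
        (NegIdx (cmXW (L : Type) (frameD V) (lineVec (L : Type) (dW c.D 0)) (fun _ => dW_real c.D 0) ι₁ (cmPlace (L : Type) ι₁)))))
        (Φ₁₀' (dotProductEquiv ℂ (Fin 2) b)) =
      Φ₁₀' (dotProductEquiv ℂ (Fin 2) ((kV.1 : Matrix (Fin 2) (Fin 2) ℂ) *ᵥ b)))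
  (hχ₀' : ∀ u : stabilizer U21 x₀,
    ((lineScalar_zero V c.D hGR hGR₀ hGR₁ (eta₀ V c.D η) (u : U21) : ℂˣ) : ℂ) *
        ((matA (stabilizerEquivK21.symm u)).det ^ ev₀'.eP * sclD (stabilizerEquivK21.symm u) ^ ev₀'.eQ) =
      star (sclD (stabilizerEquivK21.symm u)))

variable
  (Φ₁₁' : Module.Dual ℂ (Fin 2 → ℂ) →ₗ[ℂ]
    SchwartzMap (DPIdx (Fin 2) Unit
      (PosIdx (cmXW (L : Type) (frameD V) (lineVec (L : Type) (dW c.D 1)) (fun _ => dW_real c.D 1) ι₁ (cmPlace (L : Type) ι₁)))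
      (NegIdx (cmXW (L : Type) (frameD V) (lineVec (L : Type) (dW c.D 1)) (fun _ => dW_real c.D 1) ι₁ (cmPlace (L : Type) ι₁))) → ℝ) ℂ)
  (Φ₂₁' : SchwartzMap ((Fin 3 × {v : {v : InfinitePlace ↥(maximalRealSubfield L) // v.IsReal} // v ≠ cmPlace (L : Type) ι₁}) → ℝ) ℂ)
  (ℓ₀₁' : Module.Dual ℂ (Fin 2 → ℂ))
  (arch₀₁' : blockFamilyOf (L : Type) e₁ (frameD V) (frameD_real V) (frameD_ne V) (lineVec (L : Type) (dW c.D 1))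
      (fun _ => dW_real c.D 1) (fun _ => dW_ne c.D 1) ι₁ (blockPosEquiv V) (blockNegEquiv V) Φ₁₁' Φ₂₁' ℓ₀₁' = (A 1).Φinf)
  (harch₁' : ∀ a : UnitaryGroup.arch (↥(maximalRealSubfield L)) L (IsCMField.complexConj L) 3 V.Hm,
    UnitaryGroup.archAt (↥(maximalRealSubfield L)) L (IsCMField.complexConj L) 3 V.Hm (UnitaryGroup.cmPlace (L : Type) ι₁)
        (NumberField.complexConj_smul_infinitePlace (L : Type) _) (IsCMField.complexConj_ne_one (L : Type)) a = 1 →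
    ∀ ℓ, ((archSideOf V c hGR hGR₀ hGR₁ hGR₂ hGR₃ η hη hηc h₁W A).P 1).ω
        (HodgeCM.Adelic.regimeEquiv L V.Hm hV
          (UnitaryGroup.archToAdelic (↥(maximalRealSubfield L)) L (IsCMField.complexConj L) 3 V.Hm a), 1)
        (testFun (↥(maximalRealSubfield L)) (Fin 3)
          (blockFamilyOf (L : Type) e₁ (frameD V) (frameD_real V) (frameD_ne V) (lineVec (L : Type) (dW c.D 1))
            (fun _ => dW_real c.D 1) (fun _ => dW_ne c.D 1) ι₁ (blockPosEquiv V) (blockNegEquiv V) Φ₁₁' Φ₂₁' ℓ) (A 1).x₀ N) =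
      testFun (↥(maximalRealSubfield L)) (Fin 3)
        (blockFamilyOf (L : Type) e₁ (frameD V) (frameD_real V) (frameD_ne V) (lineVec (L : Type) (dW c.D 1))
          (fun _ => dW_real c.D 1) (fun _ => dW_ne c.D 1) ι₁ (blockPosEquiv V) (blockNegEquiv V) Φ₁₁' Φ₂₁' ℓ) (A 1).x₀ N)
  (hfin₁' : ∀ kf : UnitaryGroup.finAdelic (↥(maximalRealSubfield L)) L (IsCMField.complexConj L) 3 V.Hm, kf ∈ Γ₀.K →
    ∀ Φinf : 𝓢((Fin 3 → mixedSpace (↥(maximalRealSubfield L))), ℂ),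
      ((archSideOf V c hGR hGR₀ hGR₁ hGR₂ hGR₃ η hη hηc h₁W A).P 1).ω
          (HodgeCM.Adelic.regimeEquiv L V.Hm hV
            (UnitaryGroup.finAdelicToAdelic (↥(maximalRealSubfield L)) L (IsCMField.complexConj L) 3 V.Hm kf), 1)
          (testFun (↥(maximalRealSubfield L)) (Fin 3) Φinf (A 1).x₀ N) =
        testFun (↥(maximalRealSubfield L)) (Fin 3) Φinf (A 1).x₀ N)
  (hsec₁' : ∀ u : stabilizer U21 x₀,
    cmBlockSection (L : Type) (frameD V) (frameD_real V) (frameD_ne V) (lineVec (L : Type) (dW c.D 1)) (fun _ => dW_real c.D 1)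
        (fun _ => dW_ne c.D 1) ι₁ (blockPosEquiv V) (blockNegEquiv V) (u21FrameEquiv (u : U21), 1) = (archSectionFrameOf V u, 1))
  {ev₁' : VacExponents}
  (hK₁' : ∀ (kk : DPK (Fin 2) Unit
      (PosIdx (cmXW (L : Type) (frameD V) (lineVec (L : Type) (dW c.D 1)) (fun _ => dW_real c.D 1) ι₁ (cmPlace (L : Type) ι₁)))
      (NegIdx (cmXW (L : Type) (frameD V) (lineVec (L : Type) (dW c.D 1)) (fun _ => dW_real c.D 1) ι₁ (cmPlace (L : Type) ι₁))))
    (Φ : SchwartzMap (DPIdx (Fin 2) Unit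
      (PosIdx (cmXW (L : Type) (frameD V) (lineVec (L : Type) (dW c.D 1)) (fun _ => dW_real c.D 1) ι₁ (cmPlace (L : Type) ι₁)))
      (NegIdx (cmXW (L : Type) (frameD V) (lineVec (L : Type) (dW c.D 1)) (fun _ => dW_real c.D 1) ι₁ (cmPlace (L : Type) ι₁))) → ℝ) ℂ),
    cmBlockRep (L : Type) e₁ (frameD V) (frameD_real V) (frameD_ne V) (lineVec (L : Type) (dW c.D 1)) (fun _ => dW_real c.D 1)
        (fun _ => dW_ne c.D 1) hGR₁ ι₁ (blockPosEquiv V) (blockNegEquiv V)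
        (cmBlockSection (L : Type) (frameD V) (frameD_real V) (frameD_ne V) (lineVec (L : Type) (dW c.D 1)) (fun _ => dW_real c.D 1)
          (fun _ => dW_ne c.D 1) ι₁ (blockPosEquiv V) (blockNegEquiv V) (κ _ _ _ _ kk)) (tensorPi Φ Φ₂₁') =
      tensorPi (κOp _ _ ev₁' kk Φ) Φ₂₁')
  (hΦ₁₁' : ∀ (kV : Matrix.unitaryGroup (Fin 2) ℂ × Matrix.unitaryGroup Unit ℂ) (b : Fin 2 → ℂ),
    unitaryOpPi (dualPairι ((kV, 1) : DPK (Fin 2) Unit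
        (PosIdx (cmXW (L : Type) (frameD V) (lineVec (L : Type) (dW c.D 1)) (fun _ => dW_real c.D 1) ι₁ (cmPlace (L : Type) ι₁)))
        (NegIdx (cmXW (L : Type) (frameD V) (lineVec (L : Type) (dW c.D 1)) (fun _ => dW_real c.D 1) ι₁ (cmPlace (L : Type) ι₁)))))
        (Φ₁₁' (dotProductEquiv ℂ (Fin 2) b)) =
      Φ₁₁' (dotProductEquiv ℂ (Fin 2) ((kV.1 : Matrix (Fin 2) (Fin 2) ℂ) *ᵥ b)))
  (hχ₁' : ∀ u : stabilizer U21 x₀,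
    ((lineScalar_one V c.D hGR hGR₀ hGR₁ (eta₁ V c.D η) (u : U21) : ℂˣ) : ℂ) *
        ((matA (stabilizerEquivK21.symm u)).det ^ ev₁'.eP * sclD (stabilizerEquivK21.symm u) ^ ev₁'.eQ) =
      star (sclD (stabilizerEquivK21.symm u)))


/-- transport of (AN) along an equality of type indices. -/
theorem ArchKTypeData.isWeaklyPDiff_cast_iff {U : Universe} {Lc : CMField} {ι : Lc →+* ℂ} {W : HermSpace3 Lc ι} {cx : SeesawCtx Lc}
    {X : ThetaSpaceInput U W cx} {k k' : Fin 4} {M : ℕ} (h : k = k') (C : ArchKTypeData X k M)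
    {P' : Type*} [NormedAddCommGroup P'] [NormedSpace ℝ P'] (e : P' → X.G₁) :
    (h ▸ C : ArchKTypeData X k' M).IsWeaklyPDiff e ↔ C.IsWeaklyPDiff e := by
  subst h; rfl

/-- **E's `C` at the honest S term, `k`-dispatched**: for `k = 0 ∨ k = 1`, the assembled term of that line (both lines' inputs supplied;
the split is on the decidable `k = 0`, the cast is on the type index only). -/
def archKTypeOfLine (k : Fin 4) (hk : k = 0 ∨ k = 1) :
    ArchKTypeData (thetaSpaceInputIn hHD hI h₁ h₃ (archSideOf V c hGR hGR₀ hGR₁ hGR₂ hGR₃ η hη hηc h₁W A) hV) k N :=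
  if h0 : k = 0 then
    h0.symm ▸ archKTypeOfLineZero hHD hI h₁ h₃ V c hGR hGR₀ hGR₁ hGR₂ hGR₃ η hη hηc h₁W A hV N Γ₀ hlevel Φ₁₀' Φ₂₀' ℓ₀₀' arch₀₀' harch₀' hfin₀' hsec₀' hK₀' hΦ₁₀' hχ₀'
  else
    (hk.resolve_left h0).symm ▸ archKTypeOfLineOne hHD hI h₁ h₃ V c hGR hGR₀ hGR₁ hGR₂ hGR₃ η hη hηc h₁W A hV N Γ₀ hlevel Φ₁₁' Φ₂₁' ℓ₀₁' arch₀₁' harch₁' hfin₁' hsec₁' hK₁' hΦ₁₁' hχ₁'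

set_option backward.isDefEq.respectTransparency false in
/-- **ROW 14 for the dispatched term**, from the two lines' slot data. -/
theorem isWeaklyPDiff_archKTypeOfLine (k : Fin 4) (hk : k = 0 ∨ k = 1)
    (hslot₀' : ∃ ω₁ : Representation ℂ
        (Ginf (Fin 2) Unit
          (PosIdx (cmXW (L : Type) (frameD V) (lineVec (L : Type) (dW c.D 0)) (fun _ => dW_real c.D 0) ι₁ (cmPlace (L : Type) ι₁)))
          (NegIdx (cmXW (L : Type) (frameD V) (lineVec (L : Type) (dW c.D 0)) (fun _ => dW_real c.D 0) ι₁ (cmPlace (L : Type) ι₁))))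
        (SchwartzMap (DPIdx (Fin 2) Unit
          (PosIdx (cmXW (L : Type) (frameD V) (lineVec (L : Type) (dW c.D 0)) (fun _ => dW_real c.D 0) ι₁ (cmPlace (L : Type) ι₁)))
          (NegIdx (cmXW (L : Type) (frameD V) (lineVec (L : Type) (dW c.D 0)) (fun _ => dW_real c.D 0) ι₁ (cmPlace (L : Type) ι₁))) → ℝ)
          ℂ),
      IsArchWeilDatum (ι𝕎 (Fin 2) Unit _ _) ω₁ ∧ ∀ u, Continuous (ω₁ u))
    (hslot₁' : ∃ ω₁ : Representation ℂ
        (Ginf (Fin 2) Unit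
          (PosIdx (cmXW (L : Type) (frameD V) (lineVec (L : Type) (dW c.D 1)) (fun _ => dW_real c.D 1) ι₁ (cmPlace (L : Type) ι₁)))
          (NegIdx (cmXW (L : Type) (frameD V) (lineVec (L : Type) (dW c.D 1)) (fun _ => dW_real c.D 1) ι₁ (cmPlace (L : Type) ι₁))))
        (SchwartzMap (DPIdx (Fin 2) Unit
          (PosIdx (cmXW (L : Type) (frameD V) (lineVec (L : Type) (dW c.D 1)) (fun _ => dW_real c.D 1) ι₁ (cmPlace (L : Type) ι₁)))
          (NegIdx (cmXW (L : Type) (frameD V) (lineVec (L : Type) (dW c.D 1)) (fun _ => dW_real c.D 1) ι₁ (cmPlace (L : Type) ι₁))) → ℝ)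
          ℂ),
      IsArchWeilDatum (ι𝕎 (Fin 2) Unit _ _) ω₁ ∧ ∀ u, Continuous (ω₁ u)) :
    (archKTypeOfLine hHD hI h₁ h₃ V c hGR hGR₀ hGR₁ hGR₂ hGR₃ η hη hηc h₁W A hV N Γ₀ hlevel Φ₁₀' Φ₂₀' ℓ₀₀' arch₀₀' harch₀' hfin₀' hsec₀' hK₀' hΦ₁₀' hχ₀' Φ₁₁' Φ₂₁' ℓ₀₁' arch₀₁' harch₁' hfin₁' hsec₁' hK₁' hΦ₁₁' hχ₁' k hk).IsWeaklyPDiff BallForms.expP := by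
  unfold archKTypeOfLine
  split
  · next h0 =>
    subst h0
    exact isWeaklyPDiff_archKTypeOfLineZero hHD hI h₁ h₃ V c hGR hGR₀ hGR₁ hGR₂ hGR₃ η hη hηc h₁W A hV N Γ₀ hlevel Φ₁₀' Φ₂₀' ℓ₀₀' arch₀₀' harch₀' hfin₀' hsec₀' hK₀' hΦ₁₀' hχ₀' hslot₀'
  · next h0 =>
    obtain rfl : k = 1 := hk.resolve_left h0
    exact isWeaklyPDiff_archKTypeOfLineOne hHD hI h₁ h₃ V c hGR hGR₀ hGR₁ hGR₂ hGR₃ η hη hηc h₁W A hV N Γ₀ hlevel Φ₁₁' Φ₂₁' ℓ₀₁' arch₀₁' harch₁' hfin₁' hsec₁' hK₁' hΦ₁₁' hχ₁' hslot₁'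

end Dispatch

end Line

end HodgeCM.Model

end
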